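import Summits.Ventures.PercRepro.Night2LocalD3Coloops

/-!
# PercRepro — the loss bound at `|E ∖ G| = 3`, `q = 4`, for every coloop count; the far sets without preimage (night-2, gen 12)

The `(k2)` of the regime `d = 3`: a covering set `S` with `j = k1 S` layer-0 preimages has `capS = 1 − 3j/10` and at most
`5 − j` other preimages of request `≤ 6/25`, so the served fraction is at least `cap/L_max` and every loss is at most
`(6/25)·(L_max − cap)/L_max` — `1/25` at `j = 0`, `13/200` at `j = 1`, `8/75` at `j = 2` (`loss_le_d3_of_k1`); `j ≤ 2` whenever a
member outside layer 0 exists (`kColoops_add_one_le_of_not_lay0`), so every loss is `≤ 8/75` (`loss_le_d3`) and every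
layer-2 weight `≤ (16/75)/(|G ∖ cl B| − 1)` (`w2_le_d3`).  Consequences for the far sets WITHOUT covering preimage
(`cap₂ = 1`): three coloops of `S` — `load₂ ≤ 3·16/75 = 16/25` (`load2_le_cap2_d3_of_no_preimage_three`); two coloops and
`kColoops G ≤ 1` — every loss `≤ 13/200`, `load₂ ≤ 6·13/100 = 39/50` (`load2_le_cap2_d3_of_no_preimage_two`).  These are the
sub-cases `|G ∖ S| = 1` of the open cells `k ∈ {1, 2}` of `proofs/NIGHT-2-dq3.md` §4–§5.
-/

open scoped Matroid

namespace PercRepro.Shadow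

open Finset PerFlat ThmH

variable {α : Type*} [DecidableEq α] {M : Matroid α} [M.Finite]

section Loss

variable {G S : Finset α}

open scoped Classical in
/-- `L1 S ≤ (5 − k1 S) · 6/25` at a shadow set of a flat with `|E ∖ G| = 3`. -/
theorem L1_le_d3_of_k1 (hG : G ∈ flatsQ M (4 + 1)) (hd : (gr M \ G).card = 3)
    (hS : S ∈ shadowAt M (4 + 2) 4 (Uq M (4 + 2) 4) G) :
    L1 M 4 G S ≤ (5 - (k1 M 4 G S : ℚ)) * (6 / 25) := by
  have hL := L1_le_card_mul hG hd (by norm_num) S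
  rw [phiQ_four_div_five] at hL
  have hcount := card_thin_preimages_le hS
  have h' : (((coverPreimages M (Uq M (4 + 2) 4) G S).filter (fun B => B ∉ lay0 M 4 G)).card : ℚ) ≤
      5 - (k1 M 4 G S : ℚ) := by
    have : ((coverPreimages M (Uq M (4 + 2) 4) G S).filter (fun B => B ∉ lay0 M 4 G)).card ≤ 5 - k1 M 4 G S := by
      omega
    have h2 := Nat.cast_le (α := ℚ) |>.2 this
    rw [Nat.cast_sub (by omega)] at h2
    push_cast at h2
    exact h2
  refine hL.trans ?_
  exact mul_le_mul_of_nonneg_right h' (by norm_num)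

omit [DecidableEq α] [M.Finite] in
/-- The arithmetic of the loss fraction at `d = 3`: for `j ≤ 2`, `(L_max − cap)/L_max ≤ 4/9`
(`L_max = (5 − j)·6/25`, `cap = 1 − 3j/10`). -/
theorem lossFrac_arith_d3 {j : ℕ} (hj : j ≤ 2) :
    ((5 - (j : ℚ)) * (6 / 25) - (1 - (j : ℚ) * (3 / 10))) / ((5 - (j : ℚ)) * (6 / 25)) ≤ 4 / 9 := by
  have hj' : (j : ℚ) ≤ 2 := by exact_mod_cast hj
  have hj0 : (0 : ℚ) ≤ (j : ℚ) := by positivity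
  have hpos : (0 : ℚ) < (5 - (j : ℚ)) * (6 / 25) := by nlinarith
  rw [div_le_iff₀ hpos]
  nlinarith

open scoped Classical in
/-- **The loss bound at `d = 3`**: a member outside layer 0 loses at most `(6/25)·(L_max − cap)/L_max` at a covering
set with `k1 = j` layer-0 preimages, `L_max = (5 − j)·6/25`, `cap = 1 − 3j/10` (`j ≤ 2`). -/
theorem loss_le_d3_of_k1 (hG : G ∈ flatsQ M (4 + 1)) (hd : (gr M \ G).card = 3) {B : Finset α}
    (hB : B ∈ membersIn M (Uq M (4 + 2) 4) G) (hB0 : B ∉ lay0 M 4 G) {z : α} (hz : z ∈ G \ clF M B) :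
    loss M 4 G B z ≤ (6 / 25) * (((5 - (k1 M 4 G (insert z B) : ℚ)) * (6 / 25) -
      (1 - (k1 M 4 G (insert z B) : ℚ) * (3 / 10))) / ((5 - (k1 M 4 G (insert z B) : ℚ)) * (6 / 25))) := by
  have hS : insert z B ∈ shadowAt M (4 + 2) 4 (Uq M (4 + 2) 4) G :=
    insert_mem_shadowAt (Finset.Subset.refl _) hG hB hz
  have hSG : insert z B ⊆ G := subset_of_mem_shadowAt hS
  have hk2 : k1 M 4 G (insert z B) ≤ 2 := by
    have h1 := k1_le_kColoops (M := M) (q := 4) hSG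
    have h2 := kColoops_add_one_le_of_not_lay0 hG hd (by norm_num) hB hB0
    omega
  set S := insert z B with hSdef
  set j := k1 M 4 G S with hjdef
  have hj' : (j : ℚ) ≤ 2 := by exact_mod_cast hk2
  have hj0 : (0 : ℚ) ≤ (j : ℚ) := by positivity
  have hLmax : (0 : ℚ) < (5 - (j : ℚ)) * (6 / 25) := by nlinarith
  have hcapS : capS M 4 G S = 1 - (j : ℚ) * (3 / 10) := by
    unfold capS; rw [hd]; unfold phiQ; push_cast; ring
  have hcap0 : 0 ≤ capS M 4 G S := capS_nonneg hG (by omega) hSG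
  have hreq : req M 4 B ≤ 6 / 25 := by
    have := req_le_of_not_lay0 hG hd (by norm_num) hB hB0
    rw [phiQ_four_div_five] at this
    exact this
  have hL1 : L1 M 4 G S ≤ (5 - (j : ℚ)) * (6 / 25) := L1_le_d3_of_k1 hG hd hS
  have hrhs0 : 0 ≤ ((5 - (j : ℚ)) * (6 / 25) - (1 - (j : ℚ) * (3 / 10))) / ((5 - (j : ℚ)) * (6 / 25)) := by
    apply div_nonneg _ hLmax.le
    nlinarith
  unfold loss fS
  split_ifs with hle
  · rw [sub_self, mul_zero]
    exact mul_nonneg (by norm_num) hrhs0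
  · push Not at hle
    have hLpos : 0 < L1 M 4 G S := hcap0.trans_lt hle
    have h1 : 1 - capS M 4 G S / L1 M 4 G S = (L1 M 4 G S - capS M 4 G S) / L1 M 4 G S := by field_simp
    rw [h1]
    calc req M 4 B * ((L1 M 4 G S - capS M 4 G S) / L1 M 4 G S)
        ≤ (6 / 25) * ((L1 M 4 G S - capS M 4 G S) / L1 M 4 G S) := by
          apply mul_le_mul_of_nonneg_right hreq
          exact div_nonneg (by linarith) hLpos.le
      _ ≤ (6 / 25) * (((5 - (j : ℚ)) * (6 / 25) - capS M 4 G S) / ((5 - (j : ℚ)) * (6 / 25))) := by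
          apply mul_le_mul_of_nonneg_left _ (by norm_num)
          exact ratio_mono hcap0 hLpos hL1
      _ = (6 / 25) * (((5 - (j : ℚ)) * (6 / 25) - (1 - (j : ℚ) * (3 / 10))) / ((5 - (j : ℚ)) * (6 / 25))) := by
          rw [hcapS]

open scoped Classical in
/-- **Every loss at `d = 3` is at most `8/75`** (`= (6/25)·(4/9)`). -/
theorem loss_le_d3 (hG : G ∈ flatsQ M (4 + 1)) (hd : (gr M \ G).card = 3) {B : Finset α}
    (hB : B ∈ membersIn M (Uq M (4 + 2) 4) G) (hB0 : B ∉ lay0 M 4 G) {z : α} (hz : z ∈ G \ clF M B) :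
    loss M 4 G B z ≤ 8 / 75 := by
  have h := loss_le_d3_of_k1 hG hd hB hB0 hz
  have hS : insert z B ∈ shadowAt M (4 + 2) 4 (Uq M (4 + 2) 4) G :=
    insert_mem_shadowAt (Finset.Subset.refl _) hG hB hz
  have hk2 : k1 M 4 G (insert z B) ≤ 2 := by
    have h1 := k1_le_kColoops (M := M) (q := 4) (subset_of_mem_shadowAt hS)
    have h2 := kColoops_add_one_le_of_not_lay0 hG hd (by norm_num) hB hB0
    omega
  have harith := lossFrac_arith_d3 hk2
  calc loss M 4 G B z ≤ _ := h
    _ ≤ (6 / 25) * (4 / 9) := mul_le_mul_of_nonneg_left harith (by norm_num)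
    _ = 8 / 75 := by norm_num

open scoped Classical in
/-- **Every layer-2 weight at `d = 3` is at most `(16/75)/(|G ∖ cl B| − 1)`.** -/
theorem w2_le_d3 (hG : G ∈ flatsQ M (4 + 1)) (hd : (gr M \ G).card = 3) {B : Finset α}
    (hB : B ∈ ex2 M 4 G S) : w2 M 4 G B S ≤ (16 / 75) / (((G \ clF M B).card : ℚ) - 1) := by
  obtain ⟨hBm, hB0, hBS, hsub, hcard⟩ := mem_ex2_unpack hB
  have hm : 2 ≤ (G \ clF M B).card := hcard ▸ Finset.card_le_card hsub
  have hden : (0 : ℚ) ≤ ((G \ clF M B).card : ℚ) - 1 := by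
    have : (2 : ℚ) ≤ ((G \ clF M B).card : ℚ) := by exact_mod_cast hm
    linarith
  have hsum : ∑ z ∈ S \ B, loss M 4 G B z ≤ 16 / 75 := by
    calc ∑ z ∈ S \ B, loss M 4 G B z ≤ ∑ _z ∈ S \ B, (8 : ℚ) / 75 :=
          Finset.sum_le_sum (fun z hz => loss_le_d3 hG hd hBm hB0 (hsub hz))
      _ = 16 / 75 := by rw [Finset.sum_const, hcard, nsmul_eq_mul]; norm_num
  unfold w2
  rw [if_pos ⟨hB0, hBS, hsub, hcard⟩]
  exact div_le_div_of_nonneg_right hsum hden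

open scoped Classical in
/-- `w₂ ≤ 16/75` at `d = 3`. -/
theorem w2_le_d3' (hG : G ∈ flatsQ M (4 + 1)) (hd : (gr M \ G).card = 3) {B : Finset α}
    (hB : B ∈ ex2 M 4 G S) : w2 M 4 G B S ≤ 16 / 75 := by
  refine (w2_le_d3 hG hd hB).trans ?_
  obtain ⟨-, -, -, hsub, hcard⟩ := mem_ex2_unpack hB
  have hm : 2 ≤ (G \ clF M B).card := hcard ▸ Finset.card_le_card hsub
  have : (1 : ℚ) ≤ ((G \ clF M B).card : ℚ) - 1 := by
    have : (2 : ℚ) ≤ ((G \ clF M B).card : ℚ) := by exact_mod_cast hm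
    linarith
  calc (16 / 75 : ℚ) / (((G \ clF M B).card : ℚ) - 1) ≤ (16 / 75) / 1 :=
        div_le_div_of_nonneg_left (by norm_num) (by norm_num) this
    _ = 16 / 75 := by norm_num

/-- A set without covering preimage has `cap₂ = 1`. -/
theorem cap2_eq_one_of_no_preimage {q : ℕ} (hL : L1 M q G S = 0) (hk : k1 M q G S = 0) : cap2 M q G S = 1 := by
  have hcap : capS M q G S = 1 := by unfold capS; rw [hk]; simp
  unfold cap2 fS
  rw [hL, hcap]
  simp

open scoped Classical in
/-- **A far set with three coloops and no covering preimage satisfies the column condition at `d = 3`** (every coloop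
count of `M|G`): `load₂ ≤ 3·(16/75) = 16/25 ≤ 1 = cap₂`. -/
theorem load2_le_cap2_d3_of_no_preimage_three (hG : G ∈ flatsQ M (4 + 1)) (hd : (gr M \ G).card = 3)
    (hS : S ∈ shadowAt M (4 + 2) 4 (Uq M (4 + 2) 4) G) (hL : L1 M 4 G S = 0) (hk : k1 M 4 G S = 0)
    (ha : (coloops M S).card = 3) : load2 M 4 G S ≤ cap2 M 4 G S := by
  rw [cap2_eq_one_of_no_preimage hL hk]
  have hload := load2_le_card_ex2_mul (M := M) (q := 4) (G := G) (S := S) (fun B hB => w2_le_d3' hG hd hB)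
  have hex := two_mul_card_ex2_le hG hS
  rw [ha] at hex
  have hex3 : ((ex2 M 4 G S).card : ℚ) ≤ 3 := by exact_mod_cast (by omega : (ex2 M 4 G S).card ≤ 3)
  nlinarith

omit [DecidableEq α] [M.Finite] in
/-- The loss fraction at `d = 3` with `j ≤ 1`: `(L_max − cap)/L_max ≤ 13/48`. -/
theorem lossFrac_arith_d3_one {j : ℕ} (hj : j ≤ 1) :
    ((5 - (j : ℚ)) * (6 / 25) - (1 - (j : ℚ) * (3 / 10))) / ((5 - (j : ℚ)) * (6 / 25)) ≤ 13 / 48 := by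
  have hj' : (j : ℚ) ≤ 1 := by exact_mod_cast hj
  have hj0 : (0 : ℚ) ≤ (j : ℚ) := by positivity
  have hpos : (0 : ℚ) < (5 - (j : ℚ)) * (6 / 25) := by nlinarith
  rw [div_le_iff₀ hpos]
  nlinarith

open scoped Classical in
/-- With at most one coloop of `M|G`, every loss at `d = 3` is at most `13/200`. -/
theorem loss_le_d3_of_kColoops_le_one (hG : G ∈ flatsQ M (4 + 1)) (hd : (gr M \ G).card = 3)
    (hk : kColoops M G ≤ 1) {B : Finset α} (hB : B ∈ membersIn M (Uq M (4 + 2) 4) G) (hB0 : B ∉ lay0 M 4 G)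
    {z : α} (hz : z ∈ G \ clF M B) : loss M 4 G B z ≤ 13 / 200 := by
  have h := loss_le_d3_of_k1 hG hd hB hB0 hz
  have hS : insert z B ∈ shadowAt M (4 + 2) 4 (Uq M (4 + 2) 4) G :=
    insert_mem_shadowAt (Finset.Subset.refl _) hG hB hz
  have hk1 : k1 M 4 G (insert z B) ≤ 1 := by
    have h1 := k1_le_kColoops (M := M) (q := 4) (subset_of_mem_shadowAt hS)
    omega
  have harith := lossFrac_arith_d3_one hk1
  calc loss M 4 G B z ≤ _ := h
    _ ≤ (6 / 25) * (13 / 48) := mul_le_mul_of_nonneg_left harith (by norm_num)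
    _ = 13 / 200 := by norm_num

open scoped Classical in
/-- With at most one coloop of `M|G`, `w₂ ≤ 13/100` at `d = 3`. -/
theorem w2_le_d3_of_kColoops_le_one (hG : G ∈ flatsQ M (4 + 1)) (hd : (gr M \ G).card = 3)
    (hk : kColoops M G ≤ 1) {B : Finset α} (hB : B ∈ ex2 M 4 G S) : w2 M 4 G B S ≤ 13 / 100 := by
  obtain ⟨hBm, hB0, hBS, hsub, hcard⟩ := mem_ex2_unpack hB
  have hm : 2 ≤ (G \ clF M B).card := hcard ▸ Finset.card_le_card hsub
  have hden : (1 : ℚ) ≤ ((G \ clF M B).card : ℚ) - 1 := by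
    have : (2 : ℚ) ≤ ((G \ clF M B).card : ℚ) := by exact_mod_cast hm
    linarith
  have hsum : ∑ z ∈ S \ B, loss M 4 G B z ≤ 13 / 100 := by
    calc ∑ z ∈ S \ B, loss M 4 G B z ≤ ∑ _z ∈ S \ B, (13 : ℚ) / 200 :=
          Finset.sum_le_sum (fun z hz => loss_le_d3_of_kColoops_le_one hG hd hk hBm hB0 (hsub hz))
      _ = 13 / 100 := by rw [Finset.sum_const, hcard, nsmul_eq_mul]; norm_num
  unfold w2
  rw [if_pos ⟨hB0, hBS, hsub, hcard⟩]
  calc (∑ z ∈ S \ B, loss M 4 G B z) / (((G \ clF M B).card : ℚ) - 1) ≤ (13 / 100) / 1 := by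
        apply div_le_div₀ (by norm_num) hsum (by norm_num) hden
    _ = 13 / 100 := by norm_num

open scoped Classical in
/-- **A far set with two coloops and no covering preimage satisfies the column condition at `d = 3` when `M|G` has at
most one coloop**: `load₂ ≤ 6·(13/100) = 39/50 ≤ 1 = cap₂`. -/
theorem load2_le_cap2_d3_of_no_preimage_two (hG : G ∈ flatsQ M (4 + 1)) (hd : (gr M \ G).card = 3)
    (hk : kColoops M G ≤ 1) (hS : S ∈ shadowAt M (4 + 2) 4 (Uq M (4 + 2) 4) G) (hL : L1 M 4 G S = 0)
    (hk1 : k1 M 4 G S = 0) (ha : (coloops M S).card = 2) : load2 M 4 G S ≤ cap2 M 4 G S := by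
  rw [cap2_eq_one_of_no_preimage hL hk1]
  have hload := load2_le_card_ex2_mul (M := M) (q := 4) (G := G) (S := S)
    (fun B hB => w2_le_d3_of_kColoops_le_one hG hd hk hB)
  have hex := two_mul_card_ex2_le hG hS
  rw [ha] at hex
  have hex6 : ((ex2 M 4 G S).card : ℚ) ≤ 6 := by exact_mod_cast (by omega : (ex2 M 4 G S).card ≤ 6)
  nlinarith

end Loss

end PercRepro.Shadow
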